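/-
Copyright: pub-hodgecm construction cell (mc-glue-2). Mathlib-style shim, kernel-proved, 0 proof holes.
-/
import Literature.NumberTheory.Automorphic.QuadraticRestrictionOfScalars
import Literature.NumberTheory.Automorphic.UnitaryGroupPoints
import Literature.NumberTheory.Automorphic.ClassFieldCharacter
import Mathlib.RingTheory.TensorProduct.Maps
import HarnessLib

/-!
# Quadratic base change as tensor-product isomorphisms: `E ⊗_F F_v ≃ ∏_{w ∣ v} E_w`, `E ⊗_F 𝔸_F ≃ 𝔸_E`,
and the points of the unitary group `U(J)(F_v)`, `U(J)(𝔸_F)`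

For a quadratic extension of number fields `E/F` this file proves the LITERAL tensor-product forms of local
and global base change and uses them to identify the functor-of-points unitary group of `UnitaryGroupPoints`
with the concrete local / adelic unitary groups of `UnitaryGroupAutomorphicRep`:

* `localTensorEquiv E v : E ⊗[F] F_v ≃+* ∏_{w ∣ v} E_w` (`v` finite; `LocalRing E v`), `e ⊗ a ↦ e · ι_v(a)`,
  canonical and parameter-free; `localTensorAlgEquiv` (the same map as an `F_v`-algebra isomorphism for
  Mathlib's right algebra structure `Algebra.TensorProduct.rightAlgebra`), `localTensorAlgEquivLeft` (`≃ₐ[E]`);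
  `infLocalTensorEquiv`, `infLocalTensorAlgEquiv` at infinite places (`InfLocalRing E v`);
* `finiteAdeleTensorEquiv F E : E ⊗[F] 𝔸_F^∞ ≃+* 𝔸_E^∞`, `adeleTensorEquiv F E : E ⊗[F] 𝔸_F ≃+* 𝔸_E`
  (`e ⊗ a ↦ e · (a ⊗ 1)`, `AdeleRing.baseChange`), with `≃ₐ[E]` upgrades `finiteAdeleTensorAlgEquiv`,
  `adeleTensorAlgEquiv` and the `𝔸_F`-semilinearity `adeleTensorEquiv_mul_one_tmul` (there is deliberately no
  global `Algebra 𝔸_F 𝔸_E` instance in the tree — it would clash with `Algebra.id` at `E = F`; the topological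
  statement is `quadraticAdeleEquiv : 𝔸_F × 𝔸_F ≃ₜ+ 𝔸_E` of `QuadraticAdeleBaseChange`);
* `pointsLocalEquiv : UnitaryScheme.points F E c (Fin N) J F_v ≃* UnitaryGroup.local E c N J v` and
  `pointsAdeleEquiv : UnitaryScheme.points F E c (Fin N) J 𝔸_F ≃* UnitaryGroup.adelic F E c N J` — the
  identification of the `𝔸_F`-points `U(J)(𝔸_F) ≤ GL_N(E ⊗_F 𝔸_F)` with `adelic ≤ GL_N(𝔸_E)` that
  `UnitaryGroupPoints` names as deliberately not there ("it needs the ring isomorphism `E ⊗_F 𝔸_F ≅ 𝔸_E`"),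
  now available for quadratic `E/F`; on matrices both are `GL_N` of the tensor isomorphism
  (`coe_pointsLocalEquiv`, `coe_pointsAdeleEquiv`); composed with the carriers of `QuadraticRestrictionOfScalars`
  they give the injective `pointsLocalCarrier : U(J)(F_v) →* GL_{N × 2}(F_v)` and
  `pointsAdelicCarrier : U(J)(𝔸_F) →* GL_{N × 2}(𝔸_F)` on scheme points (for `N = 3`: `U(V)(𝔸_F) → GL₆(𝔸_F)`).

## Method

Section 1 is pure algebra over commutative rings: given ring maps `ι_E : E → S`, `φ : R → S` agreeing on `F`
and quadratic coordinates `Ψ : R × R ≃+ S`, `Ψ (a, b) = φ a + φ b · ι_E δ₀` (`IsQuadraticCoordinates` of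
`QuadraticRestrictionOfScalars`) with `E = F ⊕ F δ₀`, the canonical map `quadraticTensorMap : E ⊗_F R →+* S`,
`e ⊗ r ↦ ι_E e · φ r` (`Algebra.TensorProduct.lift`) has the explicit two-sided inverse
`x ↦ 1 ⊗ re x + δ₀ ⊗ im x` (`quadraticTensorInv`), whence `quadraticTensorEquiv : E ⊗_F R ≃+* S`.  Section 2 instantiates it
with the four coordinate systems of `QuadraticRestrictionOfScalars` (`isQuadraticCoordinates_local`,
`_infLocal`, `_finiteAdele`, `_adele`); the isomorphisms themselves do not depend on the auxiliary choice of
`σ, δ` (only the bijectivity proofs use it).  Section 3 transports unitary groups along a ring isomorphism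
(`unitaryGroupMapEquiv` of `UnitaryGroupPoints`) after checking that the tensor isomorphisms intertwine
`c ⊗ 1` with `conjLocal` / `conjAdele` and send the Gram matrix `J ⊗ 1` to `adelicForm E N J`.

References: local and global base change `E ⊗_F F_v = ∏_{w ∣ v} E_w`, `E ⊗_F 𝔸_F = 𝔸_E`
[CasselsFrohlichANT1967, Ch. II §§9–10, §14]; tensor products of algebras [Lang2002, Ch. XVI §6]; unitary
groups over `𝔸_F` [Mok2014, §1].  Everything here is kernel-proved from Mathlib and the tree; no named facts.
-/

noncomputable section

open NumberField IsDedekindDomain Topology Filter Matrix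
open scoped TensorProduct

namespace Literature.NumberTheory.Automorphic

namespace UnitaryGroup

/-! ## 1. Quadratic coordinates as a tensor product: `E ⊗_F R ≃+* S` -/

section Tensor

variable {F E R S : Type*} [CommRing F] [CommRing E] [CommRing R] [CommRing S] [Algebra F E] [Algebra F R]
  (ιE : E →+* S) (φ : R →+* S) (hc : ∀ x : F, φ (algebraMap F R x) = ιE (algebraMap F E x))

/-- The ring map **`E ⊗_F R → S`, `e ⊗ r ↦ ι_E(e) · φ(r)`** determined by ring maps `ι_E : E → S`,
`φ : R → S` agreeing on `F` (the universal property of the tensor product of commutative `F`-algebras,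
with `S` an `F`-algebra through `ι_E`). [folklore] -/
def quadraticTensorMap : E ⊗[F] R →+* S :=
  letI : Algebra F S := (ιE.comp (algebraMap F E)).toAlgebra
  (Algebra.TensorProduct.lift
    ({ toRingHom := ιE, commutes' := fun _ => rfl } : E →ₐ[F] S)
    ({ toRingHom := φ, commutes' := fun x => hc x } : R →ₐ[F] S)
    (fun _ _ => Commute.all _ _)).toRingHom

include hc in
/-- `quadraticTensorMap (e ⊗ r) = ι_E e · φ r`. [folklore] -/
@[simp] theorem quadraticTensorMap_tmul (e : E) (r : R) : quadraticTensorMap ιE φ hc (e ⊗ₜ r) = ιE e * φ r := rfl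

variable {ιE φ} {Ψ : (R × R) ≃+ S} {δ₀ : E} {d : R} (h : IsQuadraticCoordinates φ Ψ (ιE δ₀) d)
  (hE : ∀ e : E, ∃ x y : F, e = algebraMap F E x + algebraMap F E y * δ₀)

/-- The candidate inverse `S → E ⊗_F R`, `x ↦ 1 ⊗ re x + δ₀ ⊗ im x`. [folklore] -/
def quadraticTensorInv (Ψ : (R × R) ≃+ S) (δ₀ : E) : S →+ E ⊗[F] R where
  toFun x := (1 : E) ⊗ₜ QuadraticCoordinates.re Ψ x + δ₀ ⊗ₜ QuadraticCoordinates.im Ψ x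
  map_zero' := by simp
  map_add' x y := by
    simp only [map_add, TensorProduct.tmul_add]
    abel

/-- `quadraticTensorInv x = 1 ⊗ re x + δ₀ ⊗ im x` (definitional). [folklore] -/
theorem quadraticTensorInv_apply (Ψ : (R × R) ≃+ S) (δ₀ : E) (x : S) :
    quadraticTensorInv (F := F) Ψ δ₀ x =
      (1 : E) ⊗ₜ QuadraticCoordinates.re Ψ x + δ₀ ⊗ₜ QuadraticCoordinates.im Ψ x := rfl

include h in
/-- `quadraticTensorMap ∘ quadraticTensorInv = id`: `ι_E 1 · φ (re x) + ι_E δ₀ · φ (im x) = x`. [folklore] -/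
theorem quadraticTensorMap_tensorInv (x : S) : quadraticTensorMap ιE φ hc (quadraticTensorInv (F := F) Ψ δ₀ x) = x := by
  rw [quadraticTensorInv_apply, map_add, quadraticTensorMap_tmul, quadraticTensorMap_tmul, map_one, one_mul, mul_comm, h.re_add_im]

include h hE in
/-- `quadraticTensorInv ∘ quadraticTensorMap = id` (checked on pure tensors `e ⊗ r` after writing `e = x + y δ₀`,
`x, y ∈ F`). [folklore] -/
theorem quadraticTensorInv_tensorMap (t : E ⊗[F] R) : quadraticTensorInv (F := F) Ψ δ₀ (quadraticTensorMap ιE φ hc t) = t := by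
  induction t using TensorProduct.induction_on with
  | zero => simp
  | add x y hx hy => rw [map_add, map_add, hx, hy]
  | tmul e r =>
    obtain ⟨x, y, rfl⟩ := hE e
    have hsplit : (algebraMap F E x + algebraMap F E y * δ₀) ⊗ₜ[F] r =
        (1 : E) ⊗ₜ (x • r) + δ₀ ⊗ₜ (y • r) := by
      rw [TensorProduct.add_tmul, Algebra.algebraMap_eq_smul_one, Algebra.algebraMap_eq_smul_one, smul_mul_assoc,
        one_mul, TensorProduct.smul_tmul, TensorProduct.smul_tmul]
    rw [hsplit, map_add, quadraticTensorMap_tmul, quadraticTensorMap_tmul, map_one, one_mul, quadraticTensorInv_apply]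
    have hx : φ (x • r) + φ (y • r) * ιE δ₀ = ιE δ₀ * φ (y • r) + φ (x • r) := by ring
    rw [add_comm (φ (x • r)), ← hx, h.re_eq, h.im_eq]

include h hE in
/-- **`E ⊗_F R ≃+* S`** when `S = φ(R) ⊕ φ(R) · ι_E(δ₀)` are quadratic coordinates and `E = F ⊕ F δ₀`:
`e ⊗ r ↦ ι_E(e) φ(r)`. [folklore] -/
theorem quadraticTensorMap_bijective : Function.Bijective (quadraticTensorMap ιE φ hc) :=
  ⟨fun a b hab => by rw [← quadraticTensorInv_tensorMap hc h hE a, ← quadraticTensorInv_tensorMap hc h hE b, hab],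
    fun x => ⟨_, quadraticTensorMap_tensorInv hc h x⟩⟩

/-- **The ring isomorphism `E ⊗_F R ≃+* S`, `e ⊗ r ↦ ι_E(e) · φ(r)`.** [folklore] -/
def quadraticTensorEquiv : E ⊗[F] R ≃+* S := RingEquiv.ofBijective (quadraticTensorMap ιE φ hc) (quadraticTensorMap_bijective hc h hE)

/-- `quadraticTensorEquiv t = quadraticTensorMap t`. [folklore] -/
@[simp] theorem quadraticTensorEquiv_apply (t : E ⊗[F] R) : quadraticTensorEquiv hc h hE t = quadraticTensorMap ιE φ hc t := rfl

/-- `quadraticTensorEquiv (e ⊗ r) = ι_E e · φ r`. [folklore] -/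
theorem quadraticTensorEquiv_tmul (e : E) (r : R) : quadraticTensorEquiv hc h hE (e ⊗ₜ r) = ιE e * φ r := rfl

/-- `quadraticTensorEquiv⁻¹ = quadraticTensorInv`: `x ↦ 1 ⊗ re x + δ₀ ⊗ im x`. [folklore] -/
theorem quadraticTensorEquiv_symm_apply (x : S) : (quadraticTensorEquiv hc h hE).symm x = quadraticTensorInv (F := F) Ψ δ₀ x := by
  apply (quadraticTensorEquiv hc h hE).injective
  rw [RingEquiv.apply_symm_apply, quadraticTensorEquiv_apply, quadraticTensorMap_tensorInv hc h]

/-- `quadraticTensorEquiv⁻¹ x = 1 ⊗ re x + δ₀ ⊗ im x`. [folklore] -/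
theorem quadraticTensorEquiv_symm_apply' (x : S) :
    (quadraticTensorEquiv hc h hE).symm x =
      (1 : E) ⊗ₜ QuadraticCoordinates.re Ψ x + δ₀ ⊗ₜ QuadraticCoordinates.im Ψ x := by
  rw [quadraticTensorEquiv_symm_apply, quadraticTensorInv_apply]

/-- `quadraticTensorEquiv (e ⊗ 1) = ι_E e`. [folklore] -/
theorem quadraticTensorEquiv_tmul_one (e : E) : quadraticTensorEquiv hc h hE (e ⊗ₜ 1) = ιE e := by
  rw [quadraticTensorEquiv_tmul, map_one, mul_one]

/-- `quadraticTensorEquiv (1 ⊗ r) = φ r`. [folklore] -/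
theorem quadraticTensorEquiv_one_tmul (r : R) : quadraticTensorEquiv hc h hE (1 ⊗ₜ r) = φ r := by
  rw [quadraticTensorEquiv_tmul, map_one, one_mul]

end Tensor

/-! ## 2. The four base-change isomorphisms `E ⊗_F F_v ≃+* ∏_{w ∣ v} E_w` (`v` finite / infinite),
`E ⊗_F 𝔸_F^∞ ≃+* 𝔸_E^∞`, `E ⊗_F 𝔸_F ≃+* 𝔸_E` (quadratic `E/F`) -/

section Instances

variable {F : Type} (E : Type) [Field F] [NumberField F] [Field E] [NumberField E] [Algebra F E]

/-- The canonical ring map `E ⊗_F F_v → ∏_{w ∣ v} E_w`, `e ⊗ a ↦ e · ι_v(a)`. [folklore] -/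
def localTensorMap (v : HeightOneSpectrum (𝓞 F)) : E ⊗[F] v.adicCompletion F →+* LocalRing E v :=
  quadraticTensorMap (algebraMap E (LocalRing E v)) (toLocalRing E v) fun x => toLocalRing_coe E v x

/-- `localTensorMap (e ⊗ a) = e · ι_v a`. [folklore] -/
@[simp] theorem localTensorMap_tmul (v : HeightOneSpectrum (𝓞 F)) (e : E) (a : v.adicCompletion F) :
    localTensorMap E v (e ⊗ₜ a) = algebraMap E (LocalRing E v) e * toLocalRing E v a := rfl

/-- For quadratic `E/F` the canonical map `E ⊗_F F_v → ∏_{w ∣ v} E_w` is bijective. [folklore] -/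
theorem localTensorMap_bijective [Algebra.IsQuadraticExtension F E] (v : HeightOneSpectrum (𝓞 F)) :
    Function.Bijective (localTensorMap E v) := by
  obtain ⟨σ, δ, hσδ, hδ⟩ := exists_algEquiv_apply_eq_neg (F := F) (E := E)
  obtain ⟨d, hd⟩ := exists_mul_self_eq_algebraMap E σ hσδ hδ
  exact quadraticTensorMap_bijective _ (isQuadraticCoordinates_local E v σ hσδ hδ hd)
    (exists_eq_add_mul_of_isQuadraticExtension E (not_mem_range_algebraMap_of_apply_eq_neg E σ hσδ hδ))

/-- **`E ⊗_F F_v ≃+* ∏_{w ∣ v} E_w`** (`v` finite, `E/F` quadratic): the canonical local base-change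
isomorphism `e ⊗ a ↦ e · ι_v(a)`. [folklore] -/
def localTensorEquiv [Algebra.IsQuadraticExtension F E] (v : HeightOneSpectrum (𝓞 F)) :
    E ⊗[F] v.adicCompletion F ≃+* LocalRing E v :=
  RingEquiv.ofBijective (localTensorMap E v) (localTensorMap_bijective E v)

/-- `localTensorEquiv (e ⊗ a) = e · ι_v a`. [folklore] -/
@[simp] theorem localTensorEquiv_tmul [Algebra.IsQuadraticExtension F E] (v : HeightOneSpectrum (𝓞 F)) (e : E)
    (a : v.adicCompletion F) :
    localTensorEquiv E v (e ⊗ₜ a) = algebraMap E (LocalRing E v) e * toLocalRing E v a := rfl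

/-- `localTensorEquiv t = localTensorMap t`. [folklore] -/
theorem localTensorEquiv_apply [Algebra.IsQuadraticExtension F E] (v : HeightOneSpectrum (𝓞 F))
    (t : E ⊗[F] v.adicCompletion F) : localTensorEquiv E v t = localTensorMap E v t := rfl

/-- The inverse in coordinates: `localTensorEquiv⁻¹ x = 1 ⊗ re x + δ ⊗ im x` for the coordinates
`Ψ_v = quadraticLocalEquiv` attached to `σ δ = -δ ≠ 0`. [folklore] -/
theorem localTensorEquiv_symm_apply [Algebra.IsQuadraticExtension F E] (v : HeightOneSpectrum (𝓞 F))
    (σ : E ≃ₐ[F] E) {δ : E} (hσδ : σ δ = -δ) (hδ : δ ≠ 0) (x : LocalRing E v) :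
    (localTensorEquiv E v).symm x =
      (1 : E) ⊗ₜ ((quadraticLocalEquiv E v σ hσδ hδ).symm x).1 + δ ⊗ₜ ((quadraticLocalEquiv E v σ hσδ hδ).symm x).2 := by
  obtain ⟨d, hd⟩ := exists_mul_self_eq_algebraMap E σ hσδ hδ
  apply (localTensorEquiv E v).injective
  rw [RingEquiv.apply_symm_apply]
  exact (quadraticTensorMap_tensorInv _ (isQuadraticCoordinates_local E v σ hσδ hδ hd) x).symm

omit [NumberField F] [NumberField E] in
open NumberField.InfinitePlace in
/-- The canonical ring map `E ⊗_F F_v → ∏_{w ∣ v} E_w` (`v` infinite), `e ⊗ a ↦ e · ι_v(a)`. [folklore] -/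
def infLocalTensorMap (v : InfinitePlace F) : E ⊗[F] v.Completion →+* InfLocalRing E v :=
  quadraticTensorMap (algebraMap E (InfLocalRing E v)) (algebraMap v.Completion (InfLocalRing E v)) fun x =>
    funext fun w => toInfPlace_coe E v w x

omit [NumberField F] [NumberField E] in
open NumberField.InfinitePlace in
/-- `infLocalTensorMap (e ⊗ a) = e · ι_v a`. [folklore] -/
@[simp] theorem infLocalTensorMap_tmul (v : InfinitePlace F) (e : E) (a : v.Completion) :
    infLocalTensorMap E v (e ⊗ₜ a) = algebraMap E (InfLocalRing E v) e * algebraMap v.Completion (InfLocalRing E v) a :=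
  rfl

open NumberField.InfinitePlace in
/-- For quadratic `E/F` the canonical map `E ⊗_F F_v → ∏_{w ∣ v} E_w` (`v` infinite) is bijective. [folklore] -/
theorem infLocalTensorMap_bijective [Algebra.IsQuadraticExtension F E] (v : InfinitePlace F) :
    Function.Bijective (infLocalTensorMap E v) := by
  obtain ⟨σ, δ, hσδ, hδ⟩ := exists_algEquiv_apply_eq_neg (F := F) (E := E)
  obtain ⟨d, hd⟩ := exists_mul_self_eq_algebraMap E σ hσδ hδ
  exact quadraticTensorMap_bijective _ (isQuadraticCoordinates_infLocal E v σ hσδ hδ hd)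
    (exists_eq_add_mul_of_isQuadraticExtension E (not_mem_range_algebraMap_of_apply_eq_neg E σ hσδ hδ))

open NumberField.InfinitePlace in
/-- **`E ⊗_F F_v ≃+* ∏_{w ∣ v} E_w`** (`v` infinite, `E/F` quadratic). [folklore] -/
def infLocalTensorEquiv [Algebra.IsQuadraticExtension F E] (v : InfinitePlace F) :
    E ⊗[F] v.Completion ≃+* InfLocalRing E v :=
  RingEquiv.ofBijective (infLocalTensorMap E v) (infLocalTensorMap_bijective E v)

open NumberField.InfinitePlace in
/-- `infLocalTensorEquiv (e ⊗ a) = e · ι_v a`. [folklore] -/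
@[simp] theorem infLocalTensorEquiv_tmul [Algebra.IsQuadraticExtension F E] (v : InfinitePlace F) (e : E)
    (a : v.Completion) :
    infLocalTensorEquiv E v (e ⊗ₜ a) =
      algebraMap E (InfLocalRing E v) e * algebraMap v.Completion (InfLocalRing E v) a := rfl

variable (F) in
/-- The canonical ring map `E ⊗_F 𝔸_F^∞ → 𝔸_E^∞`, `e ⊗ a ↦ e · (a ⊗ 1)`. [folklore] -/
def finiteAdeleTensorMap : E ⊗[F] FiniteAdeleRing (𝓞 F) F →+* FiniteAdeleRing (𝓞 E) E :=
  quadraticTensorMap (algebraMap E (FiniteAdeleRing (𝓞 E) E)) (FiniteAdeleRing.baseChange (𝓞 F) F E (𝓞 E)) fun x =>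
    FiniteAdeleRing.baseChange_algebraMap (𝓞 F) F E (𝓞 E) x

/-- `finiteAdeleTensorMap (e ⊗ a) = e · (a ⊗ 1)`. [folklore] -/
@[simp] theorem finiteAdeleTensorMap_tmul (e : E) (a : FiniteAdeleRing (𝓞 F) F) :
    finiteAdeleTensorMap F E (e ⊗ₜ a) =
      algebraMap E (FiniteAdeleRing (𝓞 E) E) e * FiniteAdeleRing.baseChange (𝓞 F) F E (𝓞 E) a := rfl

/-- For quadratic `E/F` the canonical map `E ⊗_F 𝔸_F^∞ → 𝔸_E^∞` is bijective. [folklore] -/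
theorem finiteAdeleTensorMap_bijective [Algebra.IsQuadraticExtension F E] :
    Function.Bijective (finiteAdeleTensorMap F E) := by
  obtain ⟨σ, δ, hσδ, hδ⟩ := exists_algEquiv_apply_eq_neg (F := F) (E := E)
  obtain ⟨d, hd⟩ := exists_mul_self_eq_algebraMap E σ hσδ hδ
  exact quadraticTensorMap_bijective _ (isQuadraticCoordinates_finiteAdele E σ hσδ hδ hd)
    (exists_eq_add_mul_of_isQuadraticExtension E (not_mem_range_algebraMap_of_apply_eq_neg E σ hσδ hδ))

variable (F) in
/-- **`E ⊗_F 𝔸_F^∞ ≃+* 𝔸_E^∞`** (`E/F` quadratic): the canonical finite-adelic base-change isomorphism.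
[folklore] -/
def finiteAdeleTensorEquiv [Algebra.IsQuadraticExtension F E] :
    E ⊗[F] FiniteAdeleRing (𝓞 F) F ≃+* FiniteAdeleRing (𝓞 E) E :=
  RingEquiv.ofBijective (finiteAdeleTensorMap F E) (finiteAdeleTensorMap_bijective E)

/-- `finiteAdeleTensorEquiv (e ⊗ a) = e · (a ⊗ 1)`. [folklore] -/
@[simp] theorem finiteAdeleTensorEquiv_tmul [Algebra.IsQuadraticExtension F E] (e : E) (a : FiniteAdeleRing (𝓞 F) F) :
    finiteAdeleTensorEquiv F E (e ⊗ₜ a) =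
      algebraMap E (FiniteAdeleRing (𝓞 E) E) e * FiniteAdeleRing.baseChange (𝓞 F) F E (𝓞 E) a := rfl

variable (F) in
/-- The canonical ring map `E ⊗_F 𝔸_F → 𝔸_E`, `e ⊗ a ↦ e · (a ⊗ 1)`. [folklore] -/
def adeleTensorMap : E ⊗[F] AdeleRing (𝓞 F) F →+* AdeleRing (𝓞 E) E :=
  quadraticTensorMap (algebraMap E (AdeleRing (𝓞 E) E)) (AdeleRing.baseChange F E) fun x =>
    AdeleRing.baseChange_algebraMap F E x

/-- `adeleTensorMap (e ⊗ a) = e · (a ⊗ 1)`. [folklore] -/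
@[simp] theorem adeleTensorMap_tmul (e : E) (a : AdeleRing (𝓞 F) F) :
    adeleTensorMap F E (e ⊗ₜ a) = algebraMap E (AdeleRing (𝓞 E) E) e * AdeleRing.baseChange F E a := rfl

/-- For quadratic `E/F` the canonical map `E ⊗_F 𝔸_F → 𝔸_E` is bijective. [folklore] -/
theorem adeleTensorMap_bijective [Algebra.IsQuadraticExtension F E] : Function.Bijective (adeleTensorMap F E) := by
  obtain ⟨σ, δ, hσδ, hδ⟩ := exists_algEquiv_apply_eq_neg (F := F) (E := E)
  obtain ⟨d, hd⟩ := exists_mul_self_eq_algebraMap E σ hσδ hδ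
  exact quadraticTensorMap_bijective _ (isQuadraticCoordinates_adele E σ hσδ hδ hd)
    (exists_eq_add_mul_of_isQuadraticExtension E (not_mem_range_algebraMap_of_apply_eq_neg E σ hσδ hδ))

variable (F) in
/-- **`E ⊗_F 𝔸_F ≃+* 𝔸_E`** (`E/F` quadratic): the canonical adelic base-change isomorphism
`e ⊗ a ↦ e · (a ⊗ 1)` (Cassels–Fröhlich II §14). [folklore] -/
def adeleTensorEquiv [Algebra.IsQuadraticExtension F E] : E ⊗[F] AdeleRing (𝓞 F) F ≃+* AdeleRing (𝓞 E) E :=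
  RingEquiv.ofBijective (adeleTensorMap F E) (adeleTensorMap_bijective E)

/-- `adeleTensorEquiv (e ⊗ a) = e · (a ⊗ 1)`. [folklore] -/
@[simp] theorem adeleTensorEquiv_tmul [Algebra.IsQuadraticExtension F E] (e : E) (a : AdeleRing (𝓞 F) F) :
    adeleTensorEquiv F E (e ⊗ₜ a) = algebraMap E (AdeleRing (𝓞 E) E) e * AdeleRing.baseChange F E a := rfl

/-- `adeleTensorEquiv t = adeleTensorMap t`. [folklore] -/
theorem adeleTensorEquiv_apply [Algebra.IsQuadraticExtension F E] (t : E ⊗[F] AdeleRing (𝓞 F) F) :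
    adeleTensorEquiv F E t = adeleTensorMap F E t := rfl

/-- The inverse in coordinates: `adeleTensorEquiv⁻¹ x = 1 ⊗ re x + δ ⊗ im x` for `Ψ = quadraticAdeleEquiv`
attached to `σ δ = -δ ≠ 0`. [folklore] -/
theorem adeleTensorEquiv_symm_apply [Algebra.IsQuadraticExtension F E] (σ : E ≃ₐ[F] E) {δ : E} (hσδ : σ δ = -δ)
    (hδ : δ ≠ 0) (x : AdeleRing (𝓞 E) E) :
    (adeleTensorEquiv F E).symm x =
      (1 : E) ⊗ₜ ((quadraticAdeleEquiv F E σ hσδ hδ).symm x).1 + δ ⊗ₜ ((quadraticAdeleEquiv F E σ hσδ hδ).symm x).2 := by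
  obtain ⟨d, hd⟩ := exists_mul_self_eq_algebraMap E σ hσδ hδ
  apply (adeleTensorEquiv F E).injective
  rw [RingEquiv.apply_symm_apply]
  exact (quadraticTensorMap_tensorInv _ (isQuadraticCoordinates_adele E σ hσδ hδ hd) x).symm

/-- **(b) as an `F_v`-algebra isomorphism `E ⊗_F F_v ≃ₐ[F_v] ∏_{w ∣ v} E_w`** (`v` finite, `E/F` quadratic), for
Mathlib's right `F_v`-algebra structure `Algebra.TensorProduct.rightAlgebra` on `E ⊗_F F_v` (not a global
instance, whence the `letI`). [folklore] -/
def localTensorAlgEquiv [Algebra.IsQuadraticExtension F E] (v : HeightOneSpectrum (𝓞 F)) :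
    letI : Algebra (v.adicCompletion F) (E ⊗[F] v.adicCompletion F) := Algebra.TensorProduct.rightAlgebra
    E ⊗[F] v.adicCompletion F ≃ₐ[v.adicCompletion F] LocalRing E v :=
  letI : Algebra (v.adicCompletion F) (E ⊗[F] v.adicCompletion F) := Algebra.TensorProduct.rightAlgebra
  AlgEquiv.ofRingEquiv (f := localTensorEquiv E v) fun a => by
    rw [Algebra.TensorProduct.right_algebraMap_apply, localTensorEquiv_tmul, map_one, one_mul, algebraMap_localRing_eq]

/-- `localTensorAlgEquiv` is `localTensorEquiv` on elements. [folklore] -/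
theorem localTensorAlgEquiv_apply [Algebra.IsQuadraticExtension F E] (v : HeightOneSpectrum (𝓞 F))
    (t : E ⊗[F] v.adicCompletion F) :
    letI : Algebra (v.adicCompletion F) (E ⊗[F] v.adicCompletion F) := Algebra.TensorProduct.rightAlgebra
    localTensorAlgEquiv E v t = localTensorEquiv E v t := rfl

/-- **(b) as an `E`-algebra isomorphism `E ⊗_F F_v ≃ₐ[E] ∏_{w ∣ v} E_w`** (`v` finite, `E/F` quadratic).
[folklore] -/
def localTensorAlgEquivLeft [Algebra.IsQuadraticExtension F E] (v : HeightOneSpectrum (𝓞 F)) :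
    E ⊗[F] v.adicCompletion F ≃ₐ[E] LocalRing E v :=
  AlgEquiv.ofRingEquiv (f := localTensorEquiv E v) fun e => by
    rw [Algebra.TensorProduct.algebraMap_apply, Algebra.algebraMap_self, RingHom.id_apply, localTensorEquiv_tmul,
      map_one, mul_one]

/-- `localTensorAlgEquivLeft` is `localTensorEquiv` on elements. [folklore] -/
theorem localTensorAlgEquivLeft_apply [Algebra.IsQuadraticExtension F E] (v : HeightOneSpectrum (𝓞 F))
    (t : E ⊗[F] v.adicCompletion F) : localTensorAlgEquivLeft E v t = localTensorEquiv E v t := rfl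

open NumberField.InfinitePlace in
/-- **(b) at an infinite place as an `F_v`-algebra isomorphism `E ⊗_F F_v ≃ₐ[F_v] ∏_{w ∣ v} E_w`**
(`E/F` quadratic), for the right `F_v`-algebra structure on `E ⊗_F F_v`. [folklore] -/
def infLocalTensorAlgEquiv [Algebra.IsQuadraticExtension F E] (v : InfinitePlace F) :
    letI : Algebra v.Completion (E ⊗[F] v.Completion) := Algebra.TensorProduct.rightAlgebra
    E ⊗[F] v.Completion ≃ₐ[v.Completion] InfLocalRing E v :=
  letI : Algebra v.Completion (E ⊗[F] v.Completion) := Algebra.TensorProduct.rightAlgebra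
  AlgEquiv.ofRingEquiv (f := infLocalTensorEquiv E v) fun a => by
    rw [Algebra.TensorProduct.right_algebraMap_apply, infLocalTensorEquiv_tmul, map_one, one_mul]

open NumberField.InfinitePlace in
/-- `infLocalTensorAlgEquiv` is `infLocalTensorEquiv` on elements. [folklore] -/
theorem infLocalTensorAlgEquiv_apply [Algebra.IsQuadraticExtension F E] (v : InfinitePlace F)
    (t : E ⊗[F] v.Completion) :
    letI : Algebra v.Completion (E ⊗[F] v.Completion) := Algebra.TensorProduct.rightAlgebra
    infLocalTensorAlgEquiv E v t = infLocalTensorEquiv E v t := rfl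

variable (F) in
/-- **(c) as an `E`-algebra isomorphism `E ⊗_F 𝔸_F^∞ ≃ₐ[E] 𝔸_E^∞`** (`E/F` quadratic). [folklore] -/
def finiteAdeleTensorAlgEquiv [Algebra.IsQuadraticExtension F E] :
    E ⊗[F] FiniteAdeleRing (𝓞 F) F ≃ₐ[E] FiniteAdeleRing (𝓞 E) E :=
  AlgEquiv.ofRingEquiv (f := finiteAdeleTensorEquiv F E) fun e => by
    rw [Algebra.TensorProduct.algebraMap_apply, Algebra.algebraMap_self, RingHom.id_apply, finiteAdeleTensorEquiv_tmul,
      map_one, mul_one]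

/-- `finiteAdeleTensorAlgEquiv` is `finiteAdeleTensorEquiv` on elements. [folklore] -/
theorem finiteAdeleTensorAlgEquiv_apply [Algebra.IsQuadraticExtension F E] (t : E ⊗[F] FiniteAdeleRing (𝓞 F) F) :
    finiteAdeleTensorAlgEquiv F E t = finiteAdeleTensorEquiv F E t := rfl

variable (F) in
/-- **(c) as an `E`-algebra isomorphism `E ⊗_F 𝔸_F ≃ₐ[E] 𝔸_E`** (`E/F` quadratic); `𝔸_F`-linearity is
`adeleTensorEquiv_tmul` (there is deliberately no global `Algebra 𝔸_F 𝔸_E` instance in the tree: it would clash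
with `Algebra.id` at `E = F`). [folklore] -/
def adeleTensorAlgEquiv [Algebra.IsQuadraticExtension F E] : E ⊗[F] AdeleRing (𝓞 F) F ≃ₐ[E] AdeleRing (𝓞 E) E :=
  AlgEquiv.ofRingEquiv (f := adeleTensorEquiv F E) fun e => by
    rw [Algebra.TensorProduct.algebraMap_apply, Algebra.algebraMap_self, RingHom.id_apply, adeleTensorEquiv_tmul,
      map_one, mul_one]

/-- `adeleTensorAlgEquiv` is `adeleTensorEquiv` on elements. [folklore] -/
theorem adeleTensorAlgEquiv_apply [Algebra.IsQuadraticExtension F E] (t : E ⊗[F] AdeleRing (𝓞 F) F) :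
    adeleTensorAlgEquiv F E t = adeleTensorEquiv F E t := rfl

/-- `𝔸_F`-semilinearity of `adeleTensorEquiv` for the right `𝔸_F`-action: `T (t · (1 ⊗ a)) = T t · (a ⊗ 1)`.
[folklore] -/
theorem adeleTensorEquiv_mul_one_tmul [Algebra.IsQuadraticExtension F E] (t : E ⊗[F] AdeleRing (𝓞 F) F)
    (a : AdeleRing (𝓞 F) F) :
    adeleTensorEquiv F E (t * (1 ⊗ₜ a)) = adeleTensorEquiv F E t * AdeleRing.baseChange F E a := by
  rw [map_mul, adeleTensorEquiv_tmul, map_one, one_mul]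

end Instances

/-! ## 3. The unitary group's points: `U(J)(F_v) = UnitaryGroup.local`, `U(J)(𝔸_F) = UnitaryGroup.adelic` -/

section UnitaryPoints

variable {F : Type} (E : Type) [Field F] [NumberField F] [Field E] [NumberField E] [Algebra F E]
variable (c : E ≃ₐ[F] E) (N : ℕ) (J : Matrix (Fin N) (Fin N) E)

/-- `localTensorEquiv` intertwines `c ⊗ 1` on `E ⊗_F F_v` with `conjLocal` on `∏_{w ∣ v} E_w`. [folklore] -/
theorem localTensorEquiv_baseConj [Algebra.IsQuadraticExtension F E] (v : HeightOneSpectrum (𝓞 F))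
    (t : E ⊗[F] v.adicCompletion F) :
    localTensorEquiv E v (UnitaryScheme.baseConj F E (c : E →ₐ[F] E) (v.adicCompletion F) t) =
      conjLocal E c v (localTensorEquiv E v t) := by
  induction t using TensorProduct.induction_on with
  | zero => simp
  | add x y hx hy => rw [map_add, map_add, map_add, map_add, hx, hy]
  | tmul e a =>
    rw [UnitaryScheme.baseConj_tmul, localTensorEquiv_tmul, localTensorEquiv_tmul, map_mul, conjLocal_algebraMap,
      conjLocal_toLocalRing]
    rfl

/-- The base-changed Gram matrix `J ⊗ 1 ∈ M_N(E ⊗_F F_v)` maps to the local form `J ∈ M_N(∏ E_w)`. [folklore] -/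
theorem baseForm_map_localTensorEquiv [Algebra.IsQuadraticExtension F E] (v : HeightOneSpectrum (𝓞 F)) :
    (UnitaryScheme.baseForm F E (Fin N) J (v.adicCompletion F)).map
        (localTensorEquiv E v : E ⊗[F] v.adicCompletion F →+* LocalRing E v) =
      (adelicForm E N J).map (adeleToLocal E v) := by
  ext i j
  rw [adelicForm, Matrix.map_map, Matrix.map_apply, Matrix.map_apply, UnitaryScheme.baseForm_apply, RingHom.coe_coe,
    localTensorEquiv_tmul, map_one, mul_one]
  rfl

/-- **`U(J)(F_v) ≃* UnitaryGroup.local`**: the `F_v`-points of the unitary group scheme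
(`UnitaryScheme.points`, inside `GL_N(E ⊗_F F_v)`) are the local unitary group `U(J)(F_v) ≤ GL_N(∏_{w ∣ v} E_w)`
of `UnitaryGroupAutomorphicRep`, along `E ⊗_F F_v ≃+* ∏_{w ∣ v} E_w` (`E/F` quadratic). [folklore] -/
def pointsLocalEquiv [Algebra.IsQuadraticExtension F E] (v : HeightOneSpectrum (𝓞 F)) :
    UnitaryScheme.points F E (c : E →ₐ[F] E) (Fin N) J (v.adicCompletion F) ≃* «local» E c N J v :=
  (unitaryGroupMapEquiv (localTensorEquiv E v) (localTensorEquiv_baseConj E c v)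
      (UnitaryScheme.baseForm F E (Fin N) J (v.adicCompletion F))).trans
    (MulEquiv.subgroupCongr (by
      rw [baseForm_map_localTensorEquiv]
      exact Subgroup.ext fun _ => Iff.rfl))

/-- Underlying matrices: `pointsLocalEquiv g = GL_N(localTensorEquiv) g`. [folklore] -/
theorem coe_pointsLocalEquiv [Algebra.IsQuadraticExtension F E] (v : HeightOneSpectrum (𝓞 F))
    (g : UnitaryScheme.points F E (c : E →ₐ[F] E) (Fin N) J (v.adicCompletion F)) :
    ((pointsLocalEquiv E c N J v g : «local» E c N J v) : GL (Fin N) (LocalRing E v)) =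
      Matrix.GeneralLinearGroup.map (localTensorEquiv E v : E ⊗[F] v.adicCompletion F →+* LocalRing E v) g.1 :=
  rfl

/-- `conjAdele` fixes `𝔸_F ⊗ 1 ⊆ 𝔸_E`. [folklore] -/
theorem conjAdele_baseChange (a : AdeleRing (𝓞 F) F) :
    conjAdele F E c (AdeleRing.baseChange F E a) = AdeleRing.baseChange F E a := by
  rw [conjAdele_apply, AdeleRing.smul_baseChange]

/-- `adeleTensorEquiv` intertwines `c ⊗ 1` on `E ⊗_F 𝔸_F` with `conjAdele` on `𝔸_E`. [folklore] -/
theorem adeleTensorEquiv_baseConj [Algebra.IsQuadraticExtension F E] (t : E ⊗[F] AdeleRing (𝓞 F) F) :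
    adeleTensorEquiv F E (UnitaryScheme.baseConj F E (c : E →ₐ[F] E) (AdeleRing (𝓞 F) F) t) =
      conjAdele F E c (adeleTensorEquiv F E t) := by
  induction t using TensorProduct.induction_on with
  | zero => simp
  | add x y hx hy => rw [map_add, map_add, map_add, map_add, hx, hy]
  | tmul e a =>
    rw [UnitaryScheme.baseConj_tmul, adeleTensorEquiv_tmul, adeleTensorEquiv_tmul, map_mul, conjAdele_baseChange,
      ← algebraMap_conj]
    rfl

/-- The base-changed Gram matrix `J ⊗ 1 ∈ M_N(E ⊗_F 𝔸_F)` maps to `adelicForm = J ∈ M_N(𝔸_E)`. [folklore] -/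
theorem baseForm_map_adeleTensorEquiv [Algebra.IsQuadraticExtension F E] :
    (UnitaryScheme.baseForm F E (Fin N) J (AdeleRing (𝓞 F) F)).map
        (adeleTensorEquiv F E : E ⊗[F] AdeleRing (𝓞 F) F →+* AdeleRing (𝓞 E) E) = adelicForm E N J := by
  ext i j
  rw [adelicForm, Matrix.map_apply, Matrix.map_apply, UnitaryScheme.baseForm_apply, RingHom.coe_coe,
    adeleTensorEquiv_tmul, map_one, mul_one]

variable (F) in
/-- **`U(J)(𝔸_F) ≃* UnitaryGroup.adelic`**: the `𝔸_F`-points of the unitary group scheme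
(`UnitaryScheme.points`, inside `GL_N(E ⊗_F 𝔸_F)`) are the adelic unitary group `U(J)(𝔸_F) ≤ GL_N(𝔸_E)` of
`UnitaryGroupAutomorphicRep`, along `E ⊗_F 𝔸_F ≃+* 𝔸_E` (`E/F` quadratic) — the identification left open in
`UnitaryGroupPoints`. [folklore] -/
def pointsAdeleEquiv [Algebra.IsQuadraticExtension F E] :
    UnitaryScheme.points F E (c : E →ₐ[F] E) (Fin N) J (AdeleRing (𝓞 F) F) ≃* adelic F E c N J :=
  (unitaryGroupMapEquiv (adeleTensorEquiv F E) (adeleTensorEquiv_baseConj E c)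
      (UnitaryScheme.baseForm F E (Fin N) J (AdeleRing (𝓞 F) F))).trans
    (MulEquiv.subgroupCongr (by
      rw [baseForm_map_adeleTensorEquiv]
      exact Subgroup.ext fun _ => Iff.rfl))

/-- Underlying matrices: `pointsAdeleEquiv g = GL_N(adeleTensorEquiv) g`. [folklore] -/
theorem coe_pointsAdeleEquiv [Algebra.IsQuadraticExtension F E]
    (g : UnitaryScheme.points F E (c : E →ₐ[F] E) (Fin N) J (AdeleRing (𝓞 F) F)) :
    ((pointsAdeleEquiv F E c N J g : adelic F E c N J) : GL (Fin N) (AdeleRing (𝓞 E) E)) =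
      Matrix.GeneralLinearGroup.map (adeleTensorEquiv F E : E ⊗[F] AdeleRing (𝓞 F) F →+* AdeleRing (𝓞 E) E) g.1 :=
  rfl

/-- **`U(J)(F_v) → GL_{N × 2}(F_v)` on scheme points** (`v` finite): the composite of `pointsLocalEquiv` with the
restriction-of-scalars carrier `localUnitaryCarrier` of `QuadraticRestrictionOfScalars` — the `F_v`-points of the
unitary group scheme act `F_v`-linearly on `F_v^{N × 2}` (for `N = 3`: `U(V)(F_v) → GL₆(F_v)`). [folklore] -/
def pointsLocalCarrier [Algebra.IsQuadraticExtension F E] (v : HeightOneSpectrum (𝓞 F)) (σ : E ≃ₐ[F] E) {δ : E}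
    (hσδ : σ δ = -δ) (hδ : δ ≠ 0) {d : F} (hd : δ * δ = algebraMap F E d) :
    UnitaryScheme.points F E (c : E →ₐ[F] E) (Fin N) J (v.adicCompletion F) →* GL (Fin N × Fin 2) (v.adicCompletion F) :=
  (localUnitaryCarrier E c N J v σ hσδ hδ hd).comp (pointsLocalEquiv E c N J v).toMonoidHom

/-- `U(J)(F_v) → GL_{N × 2}(F_v)` on scheme points is injective. [folklore] -/
theorem pointsLocalCarrier_injective [Algebra.IsQuadraticExtension F E] (v : HeightOneSpectrum (𝓞 F))
    (σ : E ≃ₐ[F] E) {δ : E} (hσδ : σ δ = -δ) (hδ : δ ≠ 0) {d : F} (hd : δ * δ = algebraMap F E d) :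
    Function.Injective (pointsLocalCarrier E c N J v σ hσδ hδ hd) :=
  (localUnitaryCarrier_injective E c N J v σ hσδ hδ hd).comp (pointsLocalEquiv E c N J v).injective

variable (F) in
/-- **`U(J)(𝔸_F) → GL_{N × 2}(𝔸_F)` on scheme points**: the composite of `pointsAdeleEquiv` with the adelic
restriction-of-scalars carrier `adelicUnitaryCarrier` — the `𝔸_F`-points of the unitary group scheme act
`𝔸_F`-linearly on `𝔸_F^{N × 2}` (for `N = 3`: `U(V)(𝔸_F) → GL₆(𝔸_F)`). [folklore] -/
def pointsAdelicCarrier [Algebra.IsQuadraticExtension F E] (σ : E ≃ₐ[F] E) {δ : E} (hσδ : σ δ = -δ) (hδ : δ ≠ 0)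
    {d : F} (hd : δ * δ = algebraMap F E d) :
    UnitaryScheme.points F E (c : E →ₐ[F] E) (Fin N) J (AdeleRing (𝓞 F) F) →* GL (Fin N × Fin 2) (AdeleRing (𝓞 F) F) :=
  (adelicUnitaryCarrier F E c N J σ hσδ hδ hd).comp (pointsAdeleEquiv F E c N J).toMonoidHom

/-- `U(J)(𝔸_F) → GL_{N × 2}(𝔸_F)` on scheme points is injective. [folklore] -/
theorem pointsAdelicCarrier_injective [Algebra.IsQuadraticExtension F E] (σ : E ≃ₐ[F] E) {δ : E} (hσδ : σ δ = -δ)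
    (hδ : δ ≠ 0) {d : F} (hd : δ * δ = algebraMap F E d) :
    Function.Injective (pointsAdelicCarrier F E c N J σ hσδ hδ hd) :=
  (adelicUnitaryCarrier_injective E c N J σ hσδ hδ hd).comp (pointsAdeleEquiv F E c N J).injective

/-- Underlying matrices of `pointsLocalCarrier`: the regular representation `restrictScalars` of `GL_N` of the local
tensor isomorphism (definitional). [folklore] -/
theorem coe_pointsLocalCarrier [Algebra.IsQuadraticExtension F E] (v : HeightOneSpectrum (𝓞 F)) (σ : E ≃ₐ[F] E)
    {δ : E} (hσδ : σ δ = -δ) (hδ : δ ≠ 0) {d : F} (hd : δ * δ = algebraMap F E d)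
    (g : UnitaryScheme.points F E (c : E →ₐ[F] E) (Fin N) J (v.adicCompletion F)) :
    ((pointsLocalCarrier E c N J v σ hσδ hδ hd g : GL (Fin N × Fin 2) (v.adicCompletion F)) :
        Matrix (Fin N × Fin 2) (Fin N × Fin 2) (v.adicCompletion F)) =
      (isQuadraticCoordinates_local E v σ hσδ hδ hd).restrictScalars (Fin N)
        ((g.1 : Matrix (Fin N) (Fin N) (E ⊗[F] v.adicCompletion F)).map (localTensorEquiv E v)) :=
  rfl

/-- Underlying matrices of `pointsAdelicCarrier`: the regular representation `restrictScalars` of `GL_N` of the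
adelic tensor isomorphism (definitional). [folklore] -/
theorem coe_pointsAdelicCarrier [Algebra.IsQuadraticExtension F E] (σ : E ≃ₐ[F] E) {δ : E} (hσδ : σ δ = -δ)
    (hδ : δ ≠ 0) {d : F} (hd : δ * δ = algebraMap F E d)
    (g : UnitaryScheme.points F E (c : E →ₐ[F] E) (Fin N) J (AdeleRing (𝓞 F) F)) :
    ((pointsAdelicCarrier F E c N J σ hσδ hδ hd g : GL (Fin N × Fin 2) (AdeleRing (𝓞 F) F)) :
        Matrix (Fin N × Fin 2) (Fin N × Fin 2) (AdeleRing (𝓞 F) F)) =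
      (isQuadraticCoordinates_adele E σ hσδ hδ hd).restrictScalars (Fin N)
        ((g.1 : Matrix (Fin N) (Fin N) (E ⊗[F] AdeleRing (𝓞 F) F)).map (adeleTensorEquiv F E)) :=
  rfl

end UnitaryPoints


end UnitaryGroup

end Literature.NumberTheory.Automorphic

end
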